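import Mathlib.MeasureTheory.Integral.MeanInequalities
import Mathlib.MeasureTheory.Function.L2Space
import Literature.Analysis.FluidPDE.SobolevWholeSpace
import HarnessLib

/-!
# Nash's inequality on `ℝ³` without compact support: `(∫ u²)⁵ ≤ K⁶ (∫ |u|)⁴ (∫ ‖Du‖²)³`

Literature file (topic `Analysis/FluidPDE`, next to `PlanarNashInequalityWholeSpace`), all results
proved, no definitions, no named facts. J. Nash's inequality

  `‖u‖_{L²}^{1+2/n} ≤ C ‖u‖_{L¹}^{2/n} ‖∇u‖_{L²}`

(J. Nash, *Continuity of solutions of parabolic and elliptic equations*, Amer. J. Math. 80 (1958),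
p. 936) in dimension `n = 3`, in the integral form in which it is used in the Nash iteration for
the axisymmetric quantity `ω_θ/r`:

> H. Feng, V. Šverák, *On the Cauchy problem for axi-symmetric vortex rings*, Arch. Ration. Mech.
> Anal. 215 (2015) = arXiv:1301.6317, proof of Lemma 3.8 (arXiv p. 12): "Recall the Nash's
> inequality [N58] `∫_{ℝ³} |∇u|² dx ≥ M (∫_{ℝ³} |u|)^{−4/3} (∫_{ℝ³} |u|²)^{5/3}`"

(= Lemma 5.2 of Gallay–Šverák, Confluentes Math. 7 (2015) = arXiv:1510.01036, the input "`p = ∞`"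
of their Prop. 5.3, the tree's named fact `GallaySverak2015.VorticitySupBound`), i.e.
`(∫ u²)⁵ ≤ M⁻³ (∫ |u|)⁴ (∫ |∇u|²)³`.

## Contents (all proved)

* `lintegral_enorm_rpow_two_rpow_five_le` — the `L¹–L⁶` interpolation
  `(∫⁻ |u|²)⁵ ≤ (∫⁻ |u|)⁴ ∫⁻ |u|⁶` (Hölder with exponents `5/4`, `5`), any measure space;
* `lintegral_enorm_pow_six_le_of_gns` — `∫⁻ |u|⁶ ≤ K⁶ (∫⁻ ‖Du‖²)³` for `u ∈ C¹(ℝ³) ∩ L²`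
  (`K = SNormLESNormFDerivOfEqConst ℝ volume 2`, the tree's whole-space GNS inequality
  `eLpNorm_six_le_eLpNorm_fderiv_two`, `SobolevWholeSpace.lean`);
* `lintegral_enorm_sq_pow_five_le_nash` — **Nash, `ℝ≥0∞` form**:
  `(∫⁻ |u|²)⁵ ≤ K⁶ (∫⁻ |u|)⁴ (∫⁻ ‖Du‖²)³` for `u ∈ C¹(ℝ³)` with `u ∈ L²`;
* `pow_five_integral_sq_le_nash` — **Nash, real form**: `(∫ u²)⁵ ≤ K⁶ (∫ |u|)⁴ (∫ ‖Du‖²)³` for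
  `u ∈ C¹(ℝ³)` with `u ∈ L¹ ∩ L²`, `Du ∈ L²` — Feng–Šverák's display with `M = K⁻²`.

No compact support or decay rate is assumed (the `L²` hypothesis of the whole-space GNS only
excludes the constants); the constant is Mathlib's GNS constant for `p = 2`, `n = 3`, to the
sixth power.

## Mathlib / tree search

`lean search 'Nash|nash|L¹.*L⁶|pow_five.*integral'` (2026-08-27): the tree has the PLANAR Nash
inequality (`sq_integral_sq_le_nash`, `GaussianVortexFlatNash`; `sq_integral_sq_le_nash_of_integrable`,
`PlanarNashInequalityWholeSpace`), the `ℝ³` GNS in integral form for `C¹_c` functions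
(`integral_pow_six_le_of_gns`, `CutoffSobolevInterpolation`) and without compact support
(`eLpNorm_six_le_eLpNorm_fderiv_two`, `SobolevWholeSpace`), but no three-dimensional Nash
inequality. Mathlib (this pin): GNS only (`SobolevInequality.lean`), Hölder
`ENNReal.lintegral_mul_le_Lp_mul_Lq`, `memLp_two_iff_integrable_sq`,
`eLpNorm_eq_lintegral_rpow_enorm_toReal`, `ofReal_integral_eq_lintegral_ofReal`,
`ofReal_integral_norm_eq_lintegral_enorm`.

## References

* J. Nash, *Continuity of solutions of parabolic and elliptic equations*, Amer. J. Math. 80 (1958)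
  931–954, p. 936. [Nash1958]
* H. Feng, V. Šverák, *On the Cauchy problem for axi-symmetric vortex rings*, Arch. Ration. Mech.
  Anal. 215 (2015) 89–123 = arXiv:1301.6317, proof of Lemma 3.8. [FengSverak2015]
* Th. Gallay, V. Šverák, Confluentes Math. 7 (2015) 67–92 = arXiv:1510.01036, Lemma 5.2 and the
  proof of Prop. 5.3 ("The celebrated Nash inequality [Na]", there on `Ω`). [GallaySverak2016]
* L. C. Evans, *Partial Differential Equations*, 2nd ed., §5.6.1 (GNS). [Evans2010]
-/

noncomputable section

open MeasureTheory Set Function Filter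
open _root_.Topology
open scoped ENNReal NNReal

namespace Literature.Analysis.FluidPDE

/-- **`L¹–L⁶` interpolation** (Hölder with exponents `5/4`, `5`): for every measurable `u : X → ℝ`,
`(∫⁻ |u|²)⁵ ≤ (∫⁻ |u|)⁴ ∫⁻ |u|⁶` (in `ℝ≥0∞`) — the interpolation inequality for `Lᵖ` norms,
`‖u‖₂ ≤ ‖u‖₁^{2/5} ‖u‖₆^{3/5}` (`1/2 = (2/5)/1 + (3/5)/6`). [cite: Evans2010, App. B.2, interpolation inequality for Lᵖ-norms] -/
theorem lintegral_enorm_rpow_two_rpow_five_le {X : Type*} [MeasurableSpace X] (μ : Measure X)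
    {u : X → ℝ} (hu : AEStronglyMeasurable u μ) :
    (∫⁻ x, ‖u x‖ₑ ^ 2 ∂μ) ^ 5 ≤ (∫⁻ x, ‖u x‖ₑ ∂μ) ^ 4 * ∫⁻ x, ‖u x‖ₑ ^ 6 ∂μ := by
  have hpq : Real.HolderConjugate (5 / 4) 5 := Real.holderConjugate_iff.2 ⟨by norm_num, by norm_num⟩
  have hm : AEMeasurable (fun x => ‖u x‖ₑ) μ := hu.enorm
  have h := ENNReal.lintegral_mul_le_Lp_mul_Lq μ hpq (f := fun x => ‖u x‖ₑ ^ (4 / 5 : ℝ))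
    (g := fun x => ‖u x‖ₑ ^ (6 / 5 : ℝ)) (hm.pow_const _) (hm.pow_const _)
  have e1 : ∀ x, ‖u x‖ₑ ^ (4 / 5 : ℝ) * ‖u x‖ₑ ^ (6 / 5 : ℝ) = ‖u x‖ₑ ^ (2 : ℝ) := fun x => by
    rw [← ENNReal.rpow_add_of_nonneg _ _ (by norm_num) (by norm_num)]; norm_num
  have e2 : ∀ x, (‖u x‖ₑ ^ (4 / 5 : ℝ)) ^ (5 / 4 : ℝ) = ‖u x‖ₑ := fun x => by
    rw [← ENNReal.rpow_mul]; norm_num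
  have e3 : ∀ x, (‖u x‖ₑ ^ (6 / 5 : ℝ)) ^ (5 : ℝ) = ‖u x‖ₑ ^ (6 : ℝ) := fun x => by
    rw [← ENNReal.rpow_mul]; norm_num
  simp only [Pi.mul_apply, e1, e2, e3] at h
  -- raise to the `5`-th power
  have h5 := ENNReal.rpow_le_rpow h (by norm_num : (0 : ℝ) ≤ 5)
  rw [ENNReal.mul_rpow_of_nonneg _ _ (by norm_num : (0 : ℝ) ≤ 5), ← ENNReal.rpow_mul,
    ← ENNReal.rpow_mul] at h5
  norm_num at h5
  exact h5

section ThreeSpace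

variable {u : EuclideanSpace ℝ (Fin 3) → ℝ}

/-- **`Ḣ¹(ℝ³) ⊂ L⁶(ℝ³)` in integral form**: for `u ∈ C¹(ℝ³)` with `u ∈ L²`,
`∫⁻ |u|⁶ ≤ K⁶ (∫⁻ ‖Du‖²)³`, `K = SNormLESNormFDerivOfEqConst ℝ volume 2` (the tree's whole-space
Gagliardo–Nirenberg–Sobolev inequality `eLpNorm_six_le_eLpNorm_fderiv_two`, raised to the sixth
power; Evans, *PDE*, §5.6.1 Thm. 1 with `n = 3`, `p = 2`, `p* = 6`). [cite: Evans2010, §5.6.1 Thm. 1–2 (n = 3, p = 2)] -/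
theorem lintegral_enorm_pow_six_le_of_gns (hu : ContDiff ℝ 1 u) (h2 : eLpNorm u 2 volume < ∞) :
    ∫⁻ x, ‖u x‖ₑ ^ 6 ≤
      (SNormLESNormFDerivOfEqConst ℝ (volume : Measure (EuclideanSpace ℝ (Fin 3))) 2 : ℝ≥0∞) ^ 6 *
        (∫⁻ x, ‖fderiv ℝ u x‖ₑ ^ 2) ^ 3 := by
  have h := eLpNorm_six_le_eLpNorm_fderiv_two (volume : Measure (EuclideanSpace ℝ (Fin 3)))
    (F := ℝ) finrank_euclideanSpace_fin hu h2
  rw [eLpNorm_eq_lintegral_rpow_enorm_toReal (by norm_num) (by norm_num),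
    eLpNorm_eq_lintegral_rpow_enorm_toReal (by norm_num) (by norm_num)] at h
  simp only [ENNReal.toReal_ofNat] at h
  have h6 := ENNReal.rpow_le_rpow h (by norm_num : (0 : ℝ) ≤ 6)
  rw [← ENNReal.rpow_mul, ENNReal.mul_rpow_of_nonneg _ _ (by norm_num : (0 : ℝ) ≤ 6),
    ← ENNReal.rpow_mul] at h6
  norm_num at h6
  exact h6

/-- **Nash's inequality on `ℝ³`, `ℝ≥0∞` form**: for `u ∈ C¹(ℝ³)` with `u ∈ L²`,
`(∫⁻ |u|²)⁵ ≤ K⁶ (∫⁻ |u|)⁴ (∫⁻ ‖Du‖²)³` with `K = SNormLESNormFDerivOfEqConst ℝ volume 2` — i.e.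
`‖u‖₂^{1+2/n} ≤ C ‖u‖₁^{2/n} ‖Du‖₂` with `n = 3`, `C = K^{3/5}` (Nash 1958; Feng–Šverák, proof of
Lemma 3.8: "Recall the Nash's inequality [N58] `∫|∇u|² dx ≥ M (∫|u|)^{−4/3} (∫|u|²)^{5/3}`",
`M = K⁻²`). From Hölder `(∫|u|²)⁵ ≤ (∫|u|)⁴∫|u|⁶` and the Gagliardo–Nirenberg–Sobolev bound
`∫|u|⁶ ≤ K⁶(∫‖Du‖²)³`; no compact support is needed (the hypothesis `u ∈ L²` only excludes
constants). [cite: Nash1958, p. 936 (the inequality, general n); FengSverak2015, proof of Lemma 3.8, "Nash's inequality" display (arXiv p. 12)] -/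
theorem lintegral_enorm_sq_pow_five_le_nash (hu : ContDiff ℝ 1 u) (h2 : eLpNorm u 2 volume < ∞) :
    (∫⁻ x, ‖u x‖ₑ ^ 2) ^ 5 ≤
      (SNormLESNormFDerivOfEqConst ℝ (volume : Measure (EuclideanSpace ℝ (Fin 3))) 2 : ℝ≥0∞) ^ 6 *
        (∫⁻ x, ‖u x‖ₑ) ^ 4 * (∫⁻ x, ‖fderiv ℝ u x‖ₑ ^ 2) ^ 3 := by
  calc (∫⁻ x, ‖u x‖ₑ ^ 2) ^ 5 ≤ (∫⁻ x, ‖u x‖ₑ) ^ 4 * ∫⁻ x, ‖u x‖ₑ ^ 6 :=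
        lintegral_enorm_rpow_two_rpow_five_le volume hu.continuous.aestronglyMeasurable
    _ ≤ (∫⁻ x, ‖u x‖ₑ) ^ 4 *
        ((SNormLESNormFDerivOfEqConst ℝ (volume : Measure (EuclideanSpace ℝ (Fin 3))) 2 : ℝ≥0∞) ^ 6 *
          (∫⁻ x, ‖fderiv ℝ u x‖ₑ ^ 2) ^ 3) := by
        gcongr
        exact lintegral_enorm_pow_six_le_of_gns hu h2
    _ = _ := by ring

/-- **Nash's inequality on `ℝ³`** (real form): for `u ∈ C¹(ℝ³)` with `u ∈ L¹ ∩ L²` and `Du ∈ L²`,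
`(∫ u²)⁵ ≤ K⁶ (∫ |u|)⁴ (∫ ‖Du‖²)³`, `K = SNormLESNormFDerivOfEqConst ℝ volume 2` — equivalently
`‖u‖₂^{10/3} ≤ K² ‖u‖₁^{4/3} ‖Du‖₂²`, Feng–Šverák's
"`∫|∇u|² dx ≥ M (∫|u|)^{−4/3} (∫|u|²)^{5/3}`" with `M = K⁻²` (the input of the Nash iteration,
Lemma 3.8 there = Gallay–Šverák's Lemma 5.2). [cite: Nash1958, p. 936; FengSverak2015, proof of Lemma 3.8, "Nash's inequality" display (arXiv p. 12)] -/
theorem pow_five_integral_sq_le_nash (hu : ContDiff ℝ 1 u) (h1 : Integrable u)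
    (h2 : Integrable fun x => u x ^ 2) (hD : Integrable fun x => ‖fderiv ℝ u x‖ ^ 2) :
    (∫ x, u x ^ 2) ^ 5 ≤
      (SNormLESNormFDerivOfEqConst ℝ (volume : Measure (EuclideanSpace ℝ (Fin 3))) 2 : ℝ) ^ 6 *
        (∫ x, |u x|) ^ 4 * (∫ x, ‖fderiv ℝ u x‖ ^ 2) ^ 3 := by
  set K : ℝ≥0 := SNormLESNormFDerivOfEqConst ℝ (volume : Measure (EuclideanSpace ℝ (Fin 3))) 2
    with hK
  have hum : AEStronglyMeasurable u volume := hu.continuous.aestronglyMeasurable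
  have hL2 : eLpNorm u 2 volume < ∞ := ((memLp_two_iff_integrable_sq hum).2 h2).eLpNorm_lt_top
  have h := lintegral_enorm_sq_pow_five_le_nash hu hL2
  -- conversions `∫⁻ ↔ ∫`
  have eB : ∫⁻ x, ‖u x‖ₑ ^ 2 = ENNReal.ofReal (∫ x, u x ^ 2) := by
    rw [ofReal_integral_eq_lintegral_ofReal h2 (Eventually.of_forall fun x => sq_nonneg (u x))]
    refine lintegral_congr fun x => ?_
    rw [← ofReal_norm, Real.norm_eq_abs, ← ENNReal.ofReal_pow (abs_nonneg _), sq_abs]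
  have eA : ∫⁻ x, ‖u x‖ₑ = ENNReal.ofReal (∫ x, |u x|) := by
    rw [← ofReal_integral_norm_eq_lintegral_enorm h1]
    simp only [Real.norm_eq_abs]
  have eD : ∫⁻ x, ‖fderiv ℝ u x‖ₑ ^ 2 = ENNReal.ofReal (∫ x, ‖fderiv ℝ u x‖ ^ 2) := by
    rw [ofReal_integral_eq_lintegral_ofReal hD (Eventually.of_forall fun x => sq_nonneg _)]
    refine lintegral_congr fun x => ?_
    rw [← ofReal_norm, ← ENNReal.ofReal_pow (norm_nonneg _)]
  have hB0 : 0 ≤ ∫ x, u x ^ 2 := integral_nonneg fun x => sq_nonneg _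
  have hA0 : 0 ≤ ∫ x, |u x| := integral_nonneg fun x => abs_nonneg _
  have hD0 : 0 ≤ ∫ x, ‖fderiv ℝ u x‖ ^ 2 := integral_nonneg fun x => sq_nonneg _
  rw [eB, eA, eD, ← hK, ← ENNReal.ofReal_coe_nnreal, ← ENNReal.ofReal_pow hB0,
    ← ENNReal.ofReal_pow K.coe_nonneg, ← ENNReal.ofReal_pow hA0, ← ENNReal.ofReal_pow hD0,
    ← ENNReal.ofReal_mul (by positivity), ← ENNReal.ofReal_mul (by positivity)] at h
  exact (ENNReal.ofReal_le_ofReal_iff (by positivity)).1 h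

end ThreeSpace

end Literature.Analysis.FluidPDE
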